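import Mathlib
import Literature.NumberTheory.LFunctions.Zhang2022.Section4Prop22Mechanism
import HarnessLib

/-!
# Zhang (2022), typed skeleton: the counting mechanism of Proposition 2.2 (iii) with the
# height-windows as parameters (DAG node `Z22:Ded22`; GAP row G-d15-1, seam (s2))

Topic `Literature/NumberTheory/LFunctions/Zhang2022` (Landau–Siegel audit tree; verdict-neutral).
Y. Zhang, *Discrete mean estimates and the Landau–Siegel zero*, arXiv:2211.02515v1 (2022)
[Zhang2022LandauSiegel] — **an unrefereed manuscript under adjudication**. The companion file
`Section4Prop22Mechanism` proves the counting step of the §4 deduction of Proposition 2.2 (iii)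
(PDF p. 23, tex L1263–L1264: "It is also proved that the gap between any distinct zeros of `𝒜(s,ψ)`
in `Ω` is `> α(1 − c′α𝓛)`. To complete the proof of the gap assertion (iii), it now suffices to
prove [Lemma 4.7]") for a zero `ρ ∈ Ω` (window `|γ − 2πt₀| < 𝓛₁ + 2`) from hypotheses on the window
`𝓛₁ + 5/2`. This file proves the SAME lemmas with both windows as parameters — the zero in
`|γ − 2πt₀| < 𝓛₁ + W₀`, the hypotheses (zeros on the line; Lemma 4.6 (iii)) on `|t − 2πt₀| < 𝓛₁ + W`,
for any `W₀ ≤ 2`, `W₀ + 1/2 ≤ W` (the companions `ρ + w`, `|w| < α(1 + c′α𝓛) < 1/2`, of Lemma 4.7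
then stay inside the hypotheses' window) — so that the deduction can also be run with the lemmas'
PRINTED window `W = 2` for the zeros of the inner window `W₀ = 3/2` (`Section4Prop22InnerEdge`):

* `companion_facts_win`, `gap_lt_of_three_zeros_win`, `gap_gt_of_punctured_disc_win`,
  `gap_ge_of_open_punctured_disc_win` — verbatim generalisations of the `Section4Prop22Mechanism`
  lemmas of the same names (which are the case `W₀ = 2`, `W = 5/2`).

What is NOT asserted: any of Lemmas 4.2, 4.5–4.7 or Proposition 2.2 (every analytic input is a
hypothesis); nothing about Theorems 1–2 of the source; nothing bearing on the verdict on (8.24).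

## References

* Y. Zhang, arXiv:2211.02515v1 (2022), §2 Proposition 2.2 (iii) (PDF p. 7, tex L419–L421,
  restated tex L463), §4 p. 23 (tex L1263–L1277). [cite: Zhang2022LandauSiegel, §4 p. 23]
-/

noncomputable section

open Complex Real ComplexConjugate

namespace Literature.NumberTheory.LFunctions.Zhang2022.Skeleton

section Windows
variable {D : ℕ} [NeZero D] {χ : DirichletCharacter ℂ D} {x : Chr D}

/-- A purely imaginary number has norm `|Im w|`. [folklore] -/
private theorem norm_eq_abs_im_of_re_eq_zero' {w : ℂ} (h : w.re = 0) : ‖w‖ = |w.im| := by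
  have e : w = (w.im : ℂ) * I := by
    apply Complex.ext <;> simp [h]
  rw [congrArg (fun z : ℂ => ‖z‖) e]
  simp

/-- The companions of a zero `ρ = 1/2 + iγ` (`|γ − 2πt₀| < 𝓛₁ + 2`): for `|w| < R` with `R < 1/2`,
`R ≤ log𝓛/(100𝓛)`, the point `ρ + w` lies in `Ω₁` (so `𝒜(ρ+w) = 0 ↔ L(s,ψ)L(s,ψχ)(ρ+w) = 0` once
`F ≠ 0` on `Ω₁`, Lemma 4.2) and inside the window `𝓛₁ + 5/2`, hence ON THE LINE if it is a zero
(by (i) on the wider window): `Re w = 0`. [cite: Zhang2022LandauSiegel, §4 p. 23] -/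
theorem companion_facts_win {s : ℂ} {R W₀ W : ℝ} (hsre : s.re = 1 / 2)
    (hW₀ : W₀ ≤ 2) (hW : W₀ + 1 / 2 ≤ W)
    (hsim : |s.im - 2 * π * t0 D| < ell1 D + W₀) (hR_half : R < 1 / 2)
    (hR_log : R ≤ Real.log (ell D) / (100 * ell D))
    (hF0 : ∀ z ∈ Omega1 D, Fpoly χ x z ≠ 0)
    (hline : ∀ z : ℂ, 0 < z.re → z.re < 1 → |z.im - 2 * π * t0 D| < ell1 D + W →
      LL χ x z = 0 → z.re = 1 / 2)
    {w : ℂ} (hw : ‖w‖ < R) :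
    (calA χ x (s + w) = 0 ↔ LL χ x (s + w) = 0) ∧ (calA χ x (s + w) = 0 → w.re = 0) := by
  obtain ⟨h1a, h1b⟩ := abs_le.mp (Complex.abs_re_le_norm w)
  obtain ⟨h2a, h2b⟩ := abs_le.mp (Complex.abs_im_le_norm w)
  obtain ⟨hi1, hi2⟩ := abs_lt.mp hsim
  have hΩ1 : s + w ∈ Omega1 D := by
    rw [Omega1, Lemma43.mem_Omega1_iff, Complex.add_re, Complex.add_im, hsre]
    refine ⟨by linarith, by linarith, ?_⟩
    rw [abs_lt]
    constructor <;> linarith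
  have hiff : calA χ x (s + w) = 0 ↔ LL χ x (s + w) = 0 := by
    rw [calA, div_eq_zero_iff, or_iff_left (hF0 _ hΩ1)]
  refine ⟨hiff, fun hA => ?_⟩
  have hLL := hiff.mp hA
  have h := hline (s + w) (by rw [Complex.add_re]; linarith) (by rw [Complex.add_re]; linarith)
    (by rw [Complex.add_im, abs_lt]; constructor <;> linarith) hLL
  rw [Complex.add_re, hsre] at h
  linarith

/-- **The counting step of (iii), first half**: for consecutive zeros `ρ = 1/2 + iγ`, `ρ′ = 1/2 + iγ′`
(`γ < γ′`) of `L(s,ψ)L(s,ψχ)` in `Ω`, `γ′ − γ < R₊ := α(1 + c′α𝓛)`. For otherwise the three zeros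
`ρ + w`, `|w| < R₊`, of Lemma 4.7 are `w = 0` and two purely imaginary `w` (on the line by (i)) of
modulus in `(R₋, R₊)` (`R₋ := α(1 − c′α𝓛)`, Lemma 4.6 (iii) at `ρ`, closed disc); both below `ρ` is
impossible (Lemma 4.6 (iii) at the upper one: their distance is `≤ R₊ − R₋ ≤ R₋`), and one above `ρ`
is a zero of `L(s,ψ)L(s,ψχ)` in `Ω` strictly between `ρ` and `ρ′`.
[cite: Zhang2022LandauSiegel, §4 p. 23, tex L1263–L1264] -/
theorem gap_lt_of_three_zeros_win {s s' : ℂ} {Rp Rm W₀ W : ℝ} (hα : 0 < alpha D)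
    (hRR : Rp - Rm ≤ Rm) (hR_half : Rp < 1 / 2) (hR_log : Rp ≤ Real.log (ell D) / (100 * ell D))
    (hF0 : ∀ z ∈ Omega1 D, Fpoly χ x z ≠ 0)
    (hline : ∀ z : ℂ, 0 < z.re → z.re < 1 → |z.im - 2 * π * t0 D| < ell1 D + W →
      LL χ x z = 0 → z.re = 1 / 2)
    (h46D : ∀ ρ : ℂ, calA χ x ρ = 0 → 1 / 2 ≤ ρ.re → ρ.re < 1 / 2 + alpha D ^ 2 →
      |ρ.im - 2 * π * t0 D| < ell1 D + W →
        ∀ w : ℂ, 0 < ‖w‖ → ‖w‖ < Rm → calA χ x (ρ + w) ≠ 0)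
    (hT3 : {w : ℂ | ‖w‖ < Rp ∧ calA χ x (s + w) = 0}.ncard = 3)
    (hsre : s.re = 1 / 2) (hW₀ : W₀ ≤ 2) (hW : W₀ + 1 / 2 ≤ W)
    (hsim : |s.im - 2 * π * t0 D| < ell1 D + W₀) (hsz : LL χ x s = 0)
    (hs'im : |s'.im - 2 * π * t0 D| < ell1 D + 2)
    (hcons : ∀ s'' ∈ prodZeroSetOmega χ x, ¬ (s.im < s''.im ∧ s''.im < s'.im)) :
    s'.im - s.im < Rp := by
  set T : Set ℂ := {w : ℂ | ‖w‖ < Rp ∧ calA χ x (s + w) = 0} with hT_def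
  obtain ⟨hi1, hi2⟩ := abs_lt.mp hsim
  obtain ⟨hi1', hi2'⟩ := abs_lt.mp hs'im
  -- facts about the elements of `T`
  have hfacts : ∀ w ∈ T, (LL χ x (s + w) = 0) ∧ w.re = 0 := by
    intro w hw
    have h := companion_facts_win hsre hW₀ hW hsim hR_half hR_log hF0 hline hw.1
    exact ⟨h.1.mp hw.2, h.2 hw.2⟩
  have hT3' : T.ncard = 3 := hT3
  have hRp0 : 0 < Rp := by
    obtain ⟨a, b, c, -, -, -, habc⟩ := Set.ncard_eq_three.mp hT3'
    have ha : a ∈ T := by rw [habc]; exact Set.mem_insert _ _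
    exact lt_of_le_of_lt (norm_nonneg a) ha.1
  have hA0 : calA χ x s = 0 := by
    have h := (companion_facts_win hsre hW₀ hW hsim hR_half hR_log hF0 hline
      (w := 0) (by rw [norm_zero]; exact hRp0)).1
    rw [add_zero] at h
    exact h.mpr hsz
  have hdisc := h46D s hA0 hsre.symm.le (by rw [hsre]; nlinarith)
    (by rw [abs_lt]; constructor <;> linarith)
  have hT_norm : ∀ w ∈ T, w ≠ 0 → Rm ≤ ‖w‖ := by
    intro w hw hne
    by_contra hlt'
    push Not at hlt'
    exact hdisc w (norm_pos_iff.mpr hne) hlt' hw.2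
  have hT_im : ∀ w ∈ T, w ≠ 0 → w.im ≠ 0 := by
    intro w hw hne him
    exact hne (Complex.ext (by rw [(hfacts w hw).2]; rfl) (by rw [him]; rfl))
  by_contra hge
  push Not at hge
  have h0T : (0 : ℂ) ∈ T := ⟨by rw [norm_zero]; exact hRp0, by rw [add_zero]; exact hA0⟩
  have hT2 : (T \ {0}).ncard = 2 := by
    rw [Set.ncard_sdiff_singleton_of_mem h0T, hT3']
  obtain ⟨u, v, huv, huv_eq⟩ := Set.ncard_eq_two.mp hT2
  have hu : u ∈ T \ {0} := by rw [huv_eq]; exact Set.mem_insert _ _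
  have hv : v ∈ T \ {0} := by rw [huv_eq]; exact Set.mem_insert_of_mem _ rfl
  obtain ⟨huT, hu0⟩ := hu
  obtain ⟨hvT, hv0⟩ := hv
  rw [Set.mem_singleton_iff] at hu0 hv0
  -- one of `u`, `v` lies above `ρ`
  have hpos : ∃ p ∈ T, 0 < p.im := by
    by_contra hnone
    push Not at hnone
    have hui : u.im < 0 := lt_of_le_of_ne (hnone u huT) (hT_im u huT hu0)
    have hvi : v.im < 0 := lt_of_le_of_ne (hnone v hvT) (hT_im v hvT hv0)
    have hun : ‖u‖ = |u.im| := norm_eq_abs_im_of_re_eq_zero' (hfacts u huT).2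
    have hvn : ‖v‖ = |v.im| := norm_eq_abs_im_of_re_eq_zero' (hfacts v hvT).2
    have hu1 := hT_norm u huT hu0
    have hu2 := huT.1
    have hv1 := hT_norm v hvT hv0
    have hv2 := hvT.1
    rw [hun, abs_of_neg hui] at hu1 hu2
    rw [hvn, abs_of_neg hvi] at hv1 hv2
    obtain ⟨-, h2b⟩ := abs_le.mp (Complex.abs_im_le_norm u)
    -- Lemma 4.6 (iii) at the zero `s + u`
    have hure : (s + u).re = 1 / 2 := by rw [Complex.add_re, hsre, (hfacts u huT).2, add_zero]
    have hdisc1 := h46D (s + u) huT.2 hure.symm.le (by rw [hure]; nlinarith)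
      (by rw [Complex.add_im, abs_lt]; constructor <;> linarith)
    have hvu_re : (v - u).re = 0 := by
      rw [Complex.sub_re, (hfacts u huT).2, (hfacts v hvT).2, sub_zero]
    have hvu : ‖v - u‖ = |v.im - u.im| := by
      rw [norm_eq_abs_im_of_re_eq_zero' hvu_re, Complex.sub_im]
    have hne : 0 < ‖v - u‖ := norm_pos_iff.mpr (sub_ne_zero.mpr huv.symm)
    obtain ⟨-, hub⟩ := abs_le.mp (Complex.abs_im_le_norm u)
    obtain ⟨-, hvb⟩ := abs_le.mp (Complex.abs_im_le_norm v)
    have hlt' : ‖v - u‖ < Rm := by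
      rw [hvu, abs_lt]
      constructor <;> linarith
    have e : s + u + (v - u) = s + v := by ring
    exact hdisc1 (v - u) hne hlt' (by rw [e]; exact hvT.2)
  obtain ⟨p, hpT, hpim⟩ := hpos
  have hpn : ‖p‖ = |p.im| := norm_eq_abs_im_of_re_eq_zero' (hfacts p hpT).2
  have hp2 : p.im < Rp := by
    have h := hpT.1
    rw [hpn, abs_of_pos hpim] at h
    exact h
  have hzΩ : s + p ∈ Omega D := by
    rw [mem_Omega_iff', Complex.add_re, Complex.add_im, hsre, (hfacts p hpT).2]
    refine ⟨by norm_num, ?_⟩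
    rw [abs_lt]
    constructor <;> linarith
  exact hcons (s + p) ⟨hzΩ, (hfacts p hpT).1⟩
    ⟨by rw [Complex.add_im]; linarith, by rw [Complex.add_im]; linarith⟩

/-- **The counting step of (iii), second half**: with `γ′ − γ < R₊`, `ρ′ − ρ = i(γ′ − γ)` is one of
the zeros `w` of `𝒜(ρ + w)`, `|w| < R₊`, and Lemma 4.6 (iii) at `ρ` (CLOSED punctured disc of radius
`R₋`) gives `γ′ − γ > R₋`. [cite: Zhang2022LandauSiegel, §4 p. 23, tex L1263–L1264] -/
theorem gap_gt_of_punctured_disc_win {s s' : ℂ} {Rp Rm W₀ W : ℝ} (hR_half : Rp < 1 / 2)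
    (hR_log : Rp ≤ Real.log (ell D) / (100 * ell D))
    (hF0 : ∀ z ∈ Omega1 D, Fpoly χ x z ≠ 0)
    (hline : ∀ z : ℂ, 0 < z.re → z.re < 1 → |z.im - 2 * π * t0 D| < ell1 D + W →
      LL χ x z = 0 → z.re = 1 / 2)
    (hdisc : ∀ w : ℂ, 0 < ‖w‖ → ‖w‖ ≤ Rm → calA χ x (s + w) ≠ 0)
    (hsre : s.re = 1 / 2) (hW₀ : W₀ ≤ 2) (hW : W₀ + 1 / 2 ≤ W)
    (hsim : |s.im - 2 * π * t0 D| < ell1 D + W₀)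
    (hs're : s'.re = 1 / 2) (hs'z : LL χ x s' = 0) (hlt : s.im < s'.im)
    (hdlt : s'.im - s.im < Rp) : Rm < s'.im - s.im := by
  have hd0 : 0 < s'.im - s.im := by linarith
  have hre0 : (s' - s).re = 0 := by rw [Complex.sub_re, hsre, hs're, sub_self]
  have hn : ‖s' - s‖ = s'.im - s.im := by
    rw [norm_eq_abs_im_of_re_eq_zero' hre0, Complex.sub_im, abs_of_pos hd0]
  have e : s + (s' - s) = s' := by ring
  have hA : calA χ x (s + (s' - s)) = 0 := by
    rw [(companion_facts_win hsre hW₀ hW hsim hR_half hR_log hF0 hline (w := s' - s)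
      (by rw [hn]; exact hdlt)).1, e]
    exact hs'z
  have hne : 0 < ‖s' - s‖ := by rw [hn]; exact hd0
  by_contra hle
  push Not at hle
  exact hdisc (s' - s) hne (by rw [hn]; exact hle) hA

/-- The same with the PRINTED open punctured disc `0 < |w| < R₋` of Lemma 4.6 (iii): only
`γ′ − γ ≥ R₋` (the second seam of GAP row G-d15-1, d02's note: equality is not excluded).
[cite: Zhang2022LandauSiegel, §4 p. 23, tex L1263–L1264] -/
theorem gap_ge_of_open_punctured_disc_win {s s' : ℂ} {Rp Rm W₀ W : ℝ} (hR_half : Rp < 1 / 2)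
    (hR_log : Rp ≤ Real.log (ell D) / (100 * ell D))
    (hF0 : ∀ z ∈ Omega1 D, Fpoly χ x z ≠ 0)
    (hline : ∀ z : ℂ, 0 < z.re → z.re < 1 → |z.im - 2 * π * t0 D| < ell1 D + W →
      LL χ x z = 0 → z.re = 1 / 2)
    (hdisc : ∀ w : ℂ, 0 < ‖w‖ → ‖w‖ < Rm → calA χ x (s + w) ≠ 0)
    (hsre : s.re = 1 / 2) (hW₀ : W₀ ≤ 2) (hW : W₀ + 1 / 2 ≤ W)
    (hsim : |s.im - 2 * π * t0 D| < ell1 D + W₀)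
    (hs're : s'.re = 1 / 2) (hs'z : LL χ x s' = 0) (hlt : s.im < s'.im)
    (hdlt : s'.im - s.im < Rp) : Rm ≤ s'.im - s.im := by
  have hd0 : 0 < s'.im - s.im := by linarith
  have hre0 : (s' - s).re = 0 := by rw [Complex.sub_re, hsre, hs're, sub_self]
  have hn : ‖s' - s‖ = s'.im - s.im := by
    rw [norm_eq_abs_im_of_re_eq_zero' hre0, Complex.sub_im, abs_of_pos hd0]
  have e : s + (s' - s) = s' := by ring
  have hA : calA χ x (s + (s' - s)) = 0 := by
    rw [(companion_facts_win hsre hW₀ hW hsim hR_half hR_log hF0 hline (w := s' - s)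
      (by rw [hn]; exact hdlt)).1, e]
    exact hs'z
  have hne : 0 < ‖s' - s‖ := by rw [hn]; exact hd0
  by_contra hlt'
  push Not at hlt'
  exact hdisc (s' - s) hne (by rw [hn]; exact hlt') hA

end Windows

end Literature.NumberTheory.LFunctions.Zhang2022.Skeleton
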